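import Summits.ResolutionOfSingularities.ResolutionOfSingularities.Theorems.LossEntryW15
import HarnessLib

/-!
# LossEntryW16 (= lens-3 g29 slice 9, part 2) — walk plumbing of the loss→entry law — the β-STEP ORDINATE LAW (h2' for β-steps)

decomp-res-lens-3, gen 29 (NODE-g29 §3bis (N6)–(N7)).  TOOL at 0.  Imports `Theorems.LossEntryW15` (§26, the row lemma).

§27 — **`betaOf_entryPts_le_betaOf_betaStep` (THE β-STEP ORDINATE LAW, pure form, PROVED)**: for a one-wall equation `G` (wall on `a`,
degrees `≥ o = r_a + s`), `g ≠ 0`, `s < q < o`, `2q+1 ≤ o+s` and an axis witness of `clean(σ_{a,b,g} G)`: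
`ŷ(entryPts s o a c (clean(σ_{a,b,g} G))) ≤ ŷ(polyPts s r a b c G)` — the lex-min ordinate does not increase through a β-loss.
(Row lemma at the vertex row ⇒ `ε ≤ x_V + y_V − 1`; row lemma at the leftmost element `L` of the row carrying the new vertex + (A)/(B)
⇒ `ŷ' ≤ y_L`; `x_L ≥ x_V`, `x_L + y_L − 1 = ε` ⇒ `y_L ≤ y_V`.)  No cleanness and no wall divisibility of `G` needed.
§28 — **`betaOf_polyPts_straightened_succ_beta_le` (walk level)**: with `polyPts_succ_beta_straightened_eq_entryPts` (slice 8 §25), at a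
β-loss `v` (chart `b`, `b_v(a) ≠ 0`, one-wall states `M e_a → M′ e_b`), for ANY re-straightening `τ′`:
`ŷ(clean σ_{c,a,τ′} F_{v+1}; frame (b;a,c)) ≤ ŷ(σ_{c,a,τ′} clean(σ_{c,b,b_v(c)−τ′b_v(a)} F_v); frame (a;b,c))`, given the source polygon is
non-empty and the straightened axis witness (NODE-g29 (N5); discharged in general in `LossEntryW18`).
`hLucas` (`q ∣ D`, `q ∤ T` ⇒ `C(D,T) = 0` in `K`) as in slice 4 (discharged from `CharP K p`, `q = p^e` there).
-/

open MvPolynomial Finset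
open Literature.AlgebraicGeometry.Resolution
open Literature.AlgebraicGeometry.Resolution.Hauser2010
open Literature.AlgebraicGeometry.Resolution.PointBlowup
open Summit.ResolutionOfSingularities.ResolutionOfSingularities.Theorems.TightDefectClasses
open Summit.ResolutionOfSingularities.ResolutionOfSingularities.Theorems.TightDefectStrongWalks
open Summit.ResolutionOfSingularities.ResolutionOfSingularities.Theorems.ItineraryCutClasses
open Summit.ResolutionOfSingularities.ResolutionOfSingularities.Theorems.BoundaryLedger
open Summit.ResolutionOfSingularities.ResolutionOfSingularities.Theorems.ProximityCut
open Summit.ResolutionOfSingularities.ResolutionOfSingularities.Theorems.LossExitCone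
open Summit.ResolutionOfSingularities.ResolutionOfSingularities.Theorems.LossPolygon

/-! ## §27 (h2') FOR β-TYPE CHAIN STEPS — THE ENTRY ORDINATE OF A ONE-WALL EQUATION DOES NOT EXCEED ITS LEX-MIN ORDINATE (NODE-g29 §3bis (N6)–(N7)) -/

namespace Summit.ResolutionOfSingularities.ResolutionOfSingularities.Theorems.LossPolygon

open MvPolynomial ConeCut

variable {K : Type} [Field K]

section BetaStepIneq

variable {a b c : Fin 3}

/-- **THE β-STEP ORDINATE LAW (PROVED).**  Frame `(a ; b, c)` with the only wall on `a` (`r b = r c = 0`, degrees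
`≥ o = r a + s`; divisibility by the wall is NOT needed), `G` any such equation, `g ≠ 0`, tail arithmetic `s < q < o`, `2q + 1 ≤ o + s`, and an axis witness `R` of
`G' = clean(σ_{a,b,g} G)` (`deg R + R c < 2q`).  Then the lex-min ordinate of the entry points `entryPts s o a c G'` (= the one-wall
polygon of the next state after a β-loss in the chart `b`, `polyPts_succ_beta_eq_entryPts`) is at most the lex-min ordinate `ŷ` of
`polyPts s r a b c G`.  Mechanism (ROW LEMMA `exists_mem_support_shear_row`): the entry abscissa is constant on rows
`{E_c, E_a+E_b}`; the row of the vertex `V` keeps a monomial, so `ε ≤ x_V + y_V − 1`; the row carrying the new vertex keeps a monomial of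
`a`-exponent `≤ L_b` (`L` its leftmost source element), which is not a `q`-th power on the line `x' = ε` ((A),(B)), so
`ŷ' ≤ y_L`; and `x_L ≥ x_V`, `x_L + y_L − 1 = ε ≤ x_V + y_V − 1` give `y_L ≤ y_V`.  No cleanness of `G` and no legality of the move are
needed. [NODE-g29 §3bis (N7); new] -/
theorem betaOf_entryPts_le_betaOf_betaStep (hab : a ≠ b) (hac : a ≠ c) (hbc : b ≠ c) {q s : ℕ} {r : Fin 3 →₀ ℕ}
    (hrb : r b = 0) (hrc : r c = 0) {g : K} (hg : g ≠ 0) {G : MvPolynomial (Fin 3) K}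
    (hdegG : ∀ D ∈ G.support, r a + s ≤ D.degree)
    (hne : (polyPts s r a b c G).Nonempty) (hsq : s < q) (hqo : q < r a + s) (hos : 2 * q + 1 ≤ r a + s + s)
    {R : Fin 3 →₀ ℕ} (hR : R ∈ (deletePthPowers q (shear a b g G)).support) (hax : R.degree + R c < 2 * q) :
    betaOf (entryPts s (r a + s) a c (deletePthPowers q (shear a b g G))) ≤ betaOf (polyPts s r a b c G) := by
  classical
  -- notation-free abbreviations
  have hos' : 2 * q ≤ r a + s + s := by omega
  have hrcQ : ((r c : ℕ) : ℚ) = 0 := by rw [hrc, Nat.cast_zero]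
  have hrbQ : ((r b : ℕ) : ℚ) = 0 := by rw [hrb, Nat.cast_zero]
  have hdegH : ∀ E ∈ (shear a b g G).support, r a + s ≤ E.degree := fun E hE =>
    le_degree_of_mem_support_shear hbc hab.symm hac.symm _ hdegG hE
  have hsub : ∀ E ∈ (deletePthPowers q (shear a b g G)).support,
      E ∈ (shear a b g G).support ∧ ¬ IsPthPowerExponent q E := fun E hE => by
    rw [support_deletePthPowers', Finset.mem_filter] at hE; exact hE
  -- (A): the axis witness bounds the entry abscissa
  have hRH := (hsub R hR).1
  have hoR := hdegH R hRH
  have hRc : R c < s := by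
    have h1 : r a + s ≤ R.degree := hoR
    have h2 : R.degree + R c < 2 * q := hax
    omega
  have hspos : (0 : ℚ) < s := by exact_mod_cast (show 0 < s by omega)
  have hε := alphaOf_entryPts_le_of_axisWitness (K := K) (i := a) hos' hR hoR hax
  -- (B): on or left of the line `x' = ε` nothing is a `q`-th power
  have hnotP : ∀ E ∈ (shear a b g G).support, E c < s →
      (entryPt s (r a + s) a c E).1 ≤ alphaOf (entryPts s (r a + s) a c (deletePthPowers q (shear a b g G))) →
      ¬ IsPthPowerExponent q E := by
    intro E hE hEc hle hP
    have hB := div_le_fst_entryPt_of_isPthPowerExponent hab hac hbc hsq hqo hP (hdegH E hE) hEc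
    have h := (hB.trans hle).trans hε
    rw [div_le_div_iff_of_pos_right hspos] at h
    linarith
  -- Step 1: the vertex monomial `V` of the source polygon and its row-minimality
  obtain ⟨V, hVf, hVeq⟩ := Finset.mem_image.mp (vertexOf_mem hne)
  rw [Finset.mem_filter] at hVf
  have hVc : V c < s := by have := hVf.2; rw [hrc, add_zero] at this; exact this
  have hxmin : ∀ D ∈ G.support, D c < s →
      (((V a : ℕ) : ℚ) - r a) / (((s : ℕ) : ℚ) + r c - V c) ≤ (((D a : ℕ) : ℚ) - r a) / (((s : ℕ) : ℚ) + r c - D c) := by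
    intro D hD hDc
    have hDmem : resPoint s r a b c D ∈ polyPts s r a b c G :=
      Finset.mem_image_of_mem _ (Finset.mem_filter.mpr ⟨hD, by rw [hrc, add_zero]; exact hDc⟩)
    have h1 := alphaOf_le_fst hDmem
    have h2 : alphaOf (polyPts s r a b c G) = (resPoint s r a b c V).1 := congrArg Prod.fst hVeq.symm
    rw [h2] at h1
    exact h1
  have hleftV : ∀ D ∈ G.support, D c = V c → D a + D b = V a + V b → V a ≤ D a := by
    intro D hD hDc hDab
    have h := hxmin D hD (by rw [hDc]; exact hVc)
    rw [hDc] at h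
    have hden : (0 : ℚ) < ((s : ℕ) : ℚ) + r c - V c := by
      rw [hrcQ, add_zero]; have : ((V c : ℕ) : ℚ) < s := by exact_mod_cast hVc
      linarith
    rw [div_le_div_iff_of_pos_right hden] at h
    have : ((V a : ℕ) : ℚ) ≤ D a := by linarith
    exact_mod_cast this
  -- Step 2: the row of `V` keeps a monomial `E₁`; Step 3: `ε ≤ x'(row V)`
  obtain ⟨E₁, hE₁H, hE₁c, hE₁ab, -⟩ := exists_mem_support_shear_row hab hac hbc hg hVf.1 hleftV
  have hE₁c' : E₁ c < s := by rw [hE₁c]; exact hVc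
  have hεV : alphaOf (entryPts s (r a + s) a c (deletePthPowers q (shear a b g G))) ≤ (entryPt s (r a + s) a c E₁).1 := by
    by_cases hP1 : IsPthPowerExponent q E₁
    · have hB := div_le_fst_entryPt_of_isPthPowerExponent hab hac hbc hsq hqo hP1 (hdegH E₁ hE₁H) hE₁c'
      refine le_trans (hε.trans ?_) hB
      exact div_le_div_of_nonneg_right (by linarith) hspos.le
    · have hE₁G' : E₁ ∈ (deletePthPowers q (shear a b g G)).support := by
        rw [support_deletePthPowers', Finset.mem_filter]; exact ⟨hE₁H, hP1⟩
      exact alphaOf_le_fst (entryPt_mem_entryPts s (r a + s) a c _ hE₁G' hE₁c')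
  -- Step 4: the new vertex `E⋆`, its source row, the row's leftmost element `L`, and the row lemma at `L`
  have hEPne : (entryPts s (r a + s) a c (deletePthPowers q (shear a b g G))).Nonempty :=
    ⟨_, entryPt_mem_entryPts s (r a + s) a c _ hR hRc⟩
  obtain ⟨Es, hEsf, hEseq⟩ := Finset.mem_image.mp (vertexOf_mem hEPne)
  rw [Finset.mem_filter] at hEsf
  have hEsH := (hsub Es hEsf.1).1
  obtain ⟨Ds, hDsG, n, hn, hDsE⟩ := exists_shearExp_eq_of_mem_support_shear hbc hab.symm hac.symm g G hEsH
  rw [shearExp_eq_iff hab hac hbc] at hDsE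
  obtain ⟨hDsb, hDsc, hDsa⟩ := hDsE
  obtain ⟨L, hLS, hLmin⟩ := Finset.exists_min_image
    (G.support.filter fun D' => D' c = Ds c ∧ D' a + D' b = Ds a + Ds b) (fun D' => D' a)
    ⟨Ds, Finset.mem_filter.mpr ⟨hDsG, rfl, rfl⟩⟩
  rw [Finset.mem_filter] at hLS
  obtain ⟨hLG, hLc, hLab⟩ := hLS
  have hleftL : ∀ D ∈ G.support, D c = L c → D a + D b = L a + L b → L a ≤ D a := fun D hD hDc hDab =>
    hLmin D (Finset.mem_filter.mpr ⟨hD, by rw [hDc, hLc], by rw [hDab, hLab]⟩)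
  obtain ⟨E₂, hE₂H, hE₂c, hE₂ab, hE₂a⟩ := exists_mem_support_shear_row hab hac hbc hg hLG hleftL
  have hLc' : L c < s := by rw [hLc, hDsc]; exact hEsf.2
  have hE₂c' : E₂ c < s := by rw [hE₂c]; exact hLc'
  -- degrees along rows
  have hdegE₂ : E₂.degree = L a + L b + L c := by rw [degree_fin3 hab hac hbc E₂]; omega
  have hdegEs : Es.degree = L a + L b + L c := by rw [degree_fin3 hab hac hbc Es]; omega
  have hdegE₁ : E₁.degree = V a + V b + V c := by rw [degree_fin3 hab hac hbc E₁]; omega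
  have hfstE₂ : (entryPt s (r a + s) a c E₂).1 = (entryPt s (r a + s) a c Es).1 := by
    rw [fst_entryPt, fst_entryPt, hdegE₂, hdegEs, hE₂c, hLc, hDsc]
  have hαEP : alphaOf (entryPts s (r a + s) a c (deletePthPowers q (shear a b g G))) = (entryPt s (r a + s) a c Es).1 :=
    congrArg Prod.fst hEseq.symm
  have hP2 : ¬ IsPthPowerExponent q E₂ := hnotP E₂ hE₂H hE₂c' (by rw [hfstE₂, hαEP])
  have hE₂G' : E₂ ∈ (deletePthPowers q (shear a b g G)).support := by
    rw [support_deletePthPowers', Finset.mem_filter]; exact ⟨hE₂H, hP2⟩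
  have hle2 := vertexOf_le (entryPt_mem_entryPts s (r a + s) a c _ hE₂G' hE₂c')
  rw [toLex_le_toLex_iff] at hle2
  have hβ' : betaOf (entryPts s (r a + s) a c (deletePthPowers q (shear a b g G))) ≤ (entryPt s (r a + s) a c E₂).2 := by
    rcases hle2 with h | ⟨-, h⟩
    · exfalso
      have : (vertexOf (entryPts s (r a + s) a c (deletePthPowers q (shear a b g G)))).1 = (entryPt s (r a + s) a c E₂).1 := by
        rw [hfstE₂]; exact congrArg Prod.fst hEseq.symm
      exact absurd this (ne_of_lt h)
    · exact h
  -- Step 5: the rational arithmetic `ŷ' ≤ E₂_a/d_L ≤ L_b/d_L ≤ V_b/d_V = ŷ`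
  have hdL : (0 : ℚ) < ((s : ℕ) : ℚ) - L c := by
    have : ((L c : ℕ) : ℚ) < s := by exact_mod_cast hLc'
    linarith
  have hdV : (0 : ℚ) < ((s : ℕ) : ℚ) - V c := by
    have : ((V c : ℕ) : ℚ) < s := by exact_mod_cast hVc
    linarith
  have hsndE₂ : (entryPt s (r a + s) a c E₂).2 ≤ ((L b : ℕ) : ℚ) / (((s : ℕ) : ℚ) - L c) := by
    rw [snd_entryPt, hE₂c]
    exact div_le_div_of_nonneg_right (by exact_mod_cast hE₂a) hdL.le
  -- (i) x_V ≤ x_L, cross-multiplied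
  have hi := hxmin L hLG hLc'
  rw [hrcQ, add_zero, div_le_div_iff₀ hdV hdL] at hi
  -- (ii) ε ≤ x'(row V), i.e. x_L + y_L − 1 ≤ x_V + y_V − 1, cross-multiplied
  have hii := hεV
  rw [hαEP, fst_entryPt, fst_entryPt, hdegEs, hdegE₁, hE₁c, show Es c = L c by rw [hLc, hDsc],
    div_le_div_iff₀ hdL hdV] at hii
  push_cast at hi hii
  -- the vertex ordinate
  have hβV : betaOf (polyPts s r a b c G) = ((V b : ℕ) : ℚ) / (((s : ℕ) : ℚ) - V c) := by
    have h : betaOf (polyPts s r a b c G) = (resPoint s r a b c V).2 := congrArg Prod.snd hVeq.symm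
    rw [h]
    show ((((V b : ℕ) : ℚ) - r b) / (((s : ℕ) : ℚ) + r c - V c)) = _
    rw [hrbQ, hrcQ, sub_zero, add_zero]
  have hLV : ((L b : ℕ) : ℚ) / (((s : ℕ) : ℚ) - L c) ≤ ((V b : ℕ) : ℚ) / (((s : ℕ) : ℚ) - V c) := by
    rw [div_le_div_iff₀ hdL hdV]
    nlinarith [hi, hii, hdL, hdV]
  rw [hβV]
  exact (hβ'.trans hsndE₂).trans hLV

end BetaStepIneq

section BetaStepWalkIneq

variable {q : ℕ} [DecidableEq K] {s₀ : State (Fin 3) K}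

/-- **(h2') AT A β-TYPE CHAIN LOSS, WALK LEVEL (PROVED up to the straightened axis witness):** at a one-wall state `v`
(`r_v = M e_a`, degrees `≥ M + s`) whose move is a loss in the chart `b ≠ a` translated along the wall letter (`b_v(a) ≠ 0`) and
leaving the one-wall state `r_{v+1} = M' e_b`, `q + M' = M + s`, and for ANY re-straightening parameter `τ′` of the new state: the
lex-min ordinate of the τ′-straightened new wall polygon (frame `(b ; a, c)`) is at most the lex-min ordinate of the source polygon of
`G = σ_{c,a,τ′} clean(σ_{c,b, b_v(c) − τ′ b_v(a)} F_v)` (frame `(a ; b, c)`), PROVIDED that source polygon is non-empty and the cleaned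
translated source `clean(σ_{a,b,b_v(a)} G)` carries an axis witness `R` (`deg R + R_c < 2q`; for `τ′ = 0` it is the pull-back of
`ConeCutAxisLaw.axis_law W (v+1) b c`, cf. `exists_axisWitness_loss_b`; for `τ′ ≠ 0` it is the STRAIGHTENED AXIS WITNESS of NODE-g29 (N5)).
[NODE-g29 §3bis (N6)–(N7); new] -/
theorem betaOf_polyPts_straightened_succ_beta_le (hs : IsRoot q s₀) (W : ForcedWalk q s₀) (v : ℕ) {a b c : Fin 3}
    (hab : a ≠ b) (hac : a ≠ c) (hbc : b ≠ c) (hj : W.j v = b)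
    (hLucas : ∀ D T : ℕ, q ∣ D → ¬ q ∣ T → ((D.choose T : ℕ) : K) = 0) (τ' : K) {s M M' : ℕ} (hoM : q + M' = M + s)
    (hord : ∀ D ∈ (W.st v).F.support, M + s ≤ D.degree) (hrva : (W.st v).r a = M) (hrvb : (W.st v).r b = 0)
    (hrvc : (W.st v).r c = 0) (hr₁b : (W.st (v + 1)).r b = M') (hr₁a : (W.st (v + 1)).r a = 0) (hr₁c : (W.st (v + 1)).r c = 0)
    (hg : W.b v a ≠ 0) (hsq : s < q) (hqo : q < M + s) (hos : 2 * q + 1 ≤ M + s + s)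
    (hne : (polyPts s (W.st v).r a b c
      (shear c a τ' (deletePthPowers q (shear c b (W.b v c - τ' * W.b v a) (W.st v).F)))).Nonempty)
    {R : Fin 3 →₀ ℕ}
    (hR : R ∈ (deletePthPowers q (shear a b (W.b v a)
      (shear c a τ' (deletePthPowers q (shear c b (W.b v c - τ' * W.b v a) (W.st v).F))))).support)
    (hax : R.degree + R c < 2 * q) :
    betaOf (polyPts s (W.st (v + 1)).r b a c (deletePthPowers q (shear c a τ' (W.st (v + 1)).F))) ≤
      betaOf (polyPts s (W.st v).r a b c
        (shear c a τ' (deletePthPowers q (shear c b (W.b v c - τ' * W.b v a) (W.st v).F)))) := by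
  classical
  rw [polyPts_succ_beta_straightened_eq_entryPts hs W v hab hac hbc hj hLucas τ' hoM hord hr₁b hr₁a hr₁c]
  have hdegG : ∀ D ∈ (shear c a τ' (deletePthPowers q (shear c b (W.b v c - τ' * W.b v a) (W.st v).F))).support,
      (W.st v).r a + s ≤ D.degree := by
    intro D hD
    rw [hrva]
    refine le_degree_of_mem_support_shear hab hac hbc _ (fun D' hD' => ?_) hD
    rw [support_deletePthPowers', Finset.mem_filter] at hD'
    exact le_degree_of_mem_support_shear hab.symm hbc hac _ hord hD'.1
  have h := betaOf_entryPts_le_betaOf_betaStep hab hac hbc hrvb hrvc hg hdegG hne hsq (by rw [hrva]; exact hqo)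
    (by rw [hrva]; exact hos) hR hax
  rw [hrva] at h
  exact h

end BetaStepWalkIneq

end Summit.ResolutionOfSingularities.ResolutionOfSingularities.Theorems.LossPolygon
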